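import Summits.KontsevichZagierPeriods.KontsevichZagierPeriods.Theorems.SoloInformedKZChainEmpty
import HarnessLib
import HarnessLib.Audit

/-!
# SoloInformed — honest chains, IV: total value is a chain invariant; no catalyst creation in `𝒮`

Solo programme `solo-KontsevichZagierPeriods-informed`, session s262 (file 6; THEOREM CH / NF.7,
complement).

Honest chains of KZ moves (and of scissors moves) preserve the TOTAL VALUE `Σ_{a ∈ x} value a` of a
finite family (`soloInformed_kzChain_sum_value_eq`, `soloInformed_scissorsChain_sum_value_eq`) —
the chain-language form of the soundness of the calculus.  Consequences: (i) in the KZ calculus a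
family created out of `{s}` by honest moves has total value `0` (consistent with the neutralised
families `{u} + N(u)` of `SoloInformedKZChainFree`, which have total value `0` by design);
(ii) in the two-move scissors calculus `𝒮` every representation in play is meant to be a volume
representation (value = volume ≥ 0), so NO non-null catalyst can be created from `{S}`:
`{S} ~_𝒮 {S} + T` forces `Σ_{T} value = 0` (`soloInformed_scissorsChain_catalyst_sum_eq_zero`) and
in particular `¬ {S} ~_𝒮 {S} + {U}` whenever `value U ≠ 0` (`soloInformed_not_scissorsChain_add`).
Hence the catalyst of `soloInformed_sub_mem_scissorsRel_iff_exists_chain` (THEOREM NF.7 (2)) cannot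
be removed by the creation trick of CH-3; its removal would be a Zylev-type cancellation theorem
for the `♭`-class of maps, which is not claimed.

References: [Kontsevich–Zagier 2001, §1.2]; this work (`nl-elimination.md` THEOREM NF.7).
-/

noncomputable section

namespace Summit.KontsevichZagierPeriods.KontsevichZagierPeriods.Theorems

open Set MeasureTheory
open Literature.ModelTheory.ExponentialFields
open Literature.NumberTheory.Transcendental Literature.NumberTheory.Transcendental.KZ

/-! ### Total value of a family -/

/-- The **total value** `Σ_{a ∈ x} value a` of a finite family of representations. [this work] -/
def soloInformedTotalValue (x : Multiset (Σ n, IntegralRep n)) : ℝ :=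
  (x.map fun a => a.2.value).sum

/-- Total value of a singleton. [folklore] -/
@[simp] theorem soloInformedTotalValue_singleton (a : Σ n, IntegralRep n) :
    soloInformedTotalValue {a} = a.2.value := by
  simp [soloInformedTotalValue]

/-- Total value is additive. [folklore] -/
@[simp] theorem soloInformedTotalValue_add (x y : Multiset (Σ n, IntegralRep n)) :
    soloInformedTotalValue (x + y) = soloInformedTotalValue x + soloInformedTotalValue y := by
  simp [soloInformedTotalValue, Multiset.map_add, Multiset.sum_add]

/-- **`eval (Σ x) = Σ_{a ∈ x} value a`.** [folklore] -/
theorem soloInformed_eval_msum (x : Multiset (Σ n, IntegralRep n)) :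
    eval (soloInformedMsum x) = soloInformedTotalValue x := by
  induction x using Multiset.induction_on with
  | empty => simp [soloInformedTotalValue]
  | cons a s ih =>
    rw [soloInformedMsum_cons, map_add, ih]
    obtain ⟨n, r⟩ := a
    have h : eval (FreeAbelianGroup.of (⟨n, r⟩ : Σ n, IntegralRep n)) = r.value := eval_of r
    simp [soloInformedTotalValue, h]

/-- **Chains over sound rewrite pairs preserve total value**: if the `ℤ`-span of `E` consists of
relations then `x ~_E y` implies `Σ_x value = Σ_y value`. [this work] -/
theorem soloInformed_chain_sum_value_eq {E : Set (Multiset (Σ n, IntegralRep n) ×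
      Multiset (Σ n, IntegralRep n))} (hE : soloInformedPairSpan E ≤ relations)
    {x y : Multiset (Σ n, IntegralRep n)} (h : SoloInformedMoveChain E x y) :
    soloInformedTotalValue x = soloInformedTotalValue y := by
  have hmem := relations_le_ker_eval_holds (hE (soloInformed_msum_sub_msum_mem_pairSpan_of_chain h))
  rw [AddMonoidHom.mem_ker, map_sub, soloInformed_eval_msum, soloInformed_eval_msum, sub_eq_zero]
    at hmem
  exact hmem

/-- **Honest KZ chains preserve total value.** [Kontsevich–Zagier 2001, §1.2; this work] -/
theorem soloInformed_kzChain_sum_value_eq {x y : Multiset (Σ n, IntegralRep n)}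
    (h : SoloInformedMoveChain soloInformedKZSteps x y) :
    soloInformedTotalValue x = soloInformedTotalValue y :=
  soloInformed_chain_sum_value_eq (soloInformed_relations_eq_pairSpan ▸ le_rfl) h

/-- **Scissors chains preserve total value.** [this work, NF.7] -/
theorem soloInformed_scissorsChain_sum_value_eq {x y : Multiset (Σ n, IntegralRep n)}
    (h : SoloInformedMoveChain soloInformedScissorsSteps x y) :
    soloInformedTotalValue x = soloInformedTotalValue y :=
  soloInformed_chain_sum_value_eq
    (soloInformed_scissorsRel_eq_pairSpan ▸ soloInformed_scissorsRel_le_relations) h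

/-! ### Consequences -/

/-- A family created out of `{s}` by honest KZ moves has total value `0`. [this work] -/
theorem soloInformed_kzChain_catalyst_sum_eq_zero {a : Σ n, IntegralRep n}
    {t : Multiset (Σ n, IntegralRep n)}
    (h : SoloInformedMoveChain soloInformedKZSteps {a} ({a} + t)) :
    soloInformedTotalValue t = 0 := by
  have h' := soloInformed_kzChain_sum_value_eq h
  rw [soloInformedTotalValue_add] at h'
  linarith

/-- **No catalyst creation in `𝒮`**: `{S} ~_𝒮 {S} + T` forces `Σ_T value = 0`. [this work, NF.7] -/
theorem soloInformed_scissorsChain_catalyst_sum_eq_zero {a : Σ n, IntegralRep n}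
    {t : Multiset (Σ n, IntegralRep n)}
    (h : SoloInformedMoveChain soloInformedScissorsSteps {a} ({a} + t)) :
    soloInformedTotalValue t = 0 := by
  have h' := soloInformed_scissorsChain_sum_value_eq h
  rw [soloInformedTotalValue_add] at h'
  linarith

/-- In particular a single representation of non-zero value (e.g. a volume representation of
positive volume) is never created out of `{S}` by scissors moves. [this work, NF.7] -/
theorem soloInformed_not_scissorsChain_add {a b : Σ n, IntegralRep n} (hb : b.2.value ≠ 0) :
    ¬ SoloInformedMoveChain soloInformedScissorsSteps {a} ({a} + {b}) := fun h =>
  hb (by simpa using soloInformed_scissorsChain_catalyst_sum_eq_zero h)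

/-- The value of a volume representation is non-negative, so in a family of volume
representations `Σ value = 0` forces every member to be null. [folklore] -/
theorem soloInformed_value_nonneg_of_isVolRep {n : ℕ} {r : IntegralRep n}
    (hr : SoloInformedIsVolRep r) : 0 ≤ r.value := by
  rw [soloInformed_value_of_isVolRep hr]
  exact measureReal_nonneg

/-- **Null catalysts only**: if `{S} ~_𝒮 {S} + T` and every member of `T` is a volume
representation, then every member of `T` has value (= volume) `0`. [this work, NF.7] -/
theorem soloInformed_scissorsChain_catalyst_null {a : Σ n, IntegralRep n}
    {t : Multiset (Σ n, IntegralRep n)} (ht : ∀ b ∈ t, SoloInformedIsVolRep b.2)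
    (h : SoloInformedMoveChain soloInformedScissorsSteps {a} ({a} + t)) :
    ∀ b ∈ t, b.2.value = 0 := by
  intro b hb
  obtain ⟨t', rfl⟩ := Multiset.exists_cons_of_mem hb
  have h0 := soloInformed_scissorsChain_catalyst_sum_eq_zero h
  simp only [soloInformedTotalValue, Multiset.map_cons, Multiset.sum_cons] at h0
  have h1 : 0 ≤ (t'.map fun c : Σ n, IntegralRep n => c.2.value).sum :=
    Multiset.sum_nonneg fun v hv => by
      obtain ⟨c, hc, rfl⟩ := Multiset.mem_map.1 hv
      exact soloInformed_value_nonneg_of_isVolRep (ht c (Multiset.mem_cons_of_mem hc))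
  have h2 := soloInformed_value_nonneg_of_isVolRep (ht b hb)
  linarith

/-- **Contrast (KZ calculus)**: the neutralised family `{u} + N(u)` of CH-3 IS created out of the
anchor by honest KZ moves, and accordingly has total value `0`. [this work] -/
theorem soloInformed_totalValue_neutralised {m : ℕ} (u : IntegralRep m) :
    soloInformedTotalValue
      ({(⟨m, u⟩ : Σ n, IntegralRep n)} + soloInformedNeutraliser ⟨m, u⟩) = 0 := by
  have h := soloInformed_kzChain_sum_value_eq (soloInformed_chain_create m u)
  rw [soloInformedTotalValue_singleton] at h
  rw [← h]
  exact soloInformedZRep_value _ _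

end Summit.KontsevichZagierPeriods.KontsevichZagierPeriods.Theorems
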